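import Summits.RiemannHypothesis.RiemannHypothesis.Theorems.PfPersistenceRatioBandGuarded
import Literature.NumberTheory.LFunctions.WeilTwoPrimePos59
import HarnessLib

/-!
# PF persistence — leaf G1.21b `(Z)`-cell: the POSITIVITY BAND `a ≤ 59/100` of the far-guarded ratio readers
(pub-rhpf barrier-prover gen 5, file 15)

**HONEST FRAMING. Long-odds mechanism / rigidity campaign; no RH claims.** Everything here is RH-free
bookkeeping about the sign-blind RATIO readers of the `(Z)`-cell; nothing bears on RH.

File 14 (`PfPersistenceRatioBandGuarded`) split the live premise `ζ ∈ GaugeRatioClassFar a_min τ` at Yoshida's cut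
`(log 3)/2 = 0.549…`, the reach of the tree's first rung. The tree holds a STRONGER RH-free positivity: the certified
two-prime theorem `weilPositivityOn_59_100 : WeilPositivityOn (59/100)` (`Literature…WeilTwoPrimePos59`). This file
moves the cut to `59/100`:

* §1 generic: where the sign of the bottom is KNOWN, the sign-blind conjuncts are plain inequalities —
  `0 ≤ ε₁`: `d ∈ gaugeRatioAt τ win ↔ (1 + τ) ε₁ ≤ τ ε₂`, `d ∈ modulusRatioAt κ win ↔ ε₁ ≤ κ ε₂`;
  `ε₁ ≤ 0`: `d ∈ gaugeRatioAt τ win ↔ -ε₁ ≤ τ (ε₂ - ε₁)` (the deep-negative reading of files 4/9).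
* §2 **POSITIVITY BAND (RH-free):** `0 ≤ ε₁(ζ(a, N))` for every window with `a ≤ 59/100` and every `N`
  (`zeta_bottomRayleigh_nonneg_of_le_59_100`), strictly positive for `a < 59/100`
  (`zeta_bottomRayleigh_pos_of_lt_59_100`); hence NO DEEP-NEGATIVE MODE on `[a_min, 59/100]` and the premise there is
  the zero-free RELATIVE-GAP inequality (`zeta_mem_gaugeRatioClassBand_59_100_iff`).
* §3 **THE 59/100 SPLIT** (`zeta_mem_gaugeRatioClassFar_iff_split_59_100`): live premise = (BAND `a ≤ 59/100`: relative
  gap over a nonnegative bottom; arch + polar + primes 2, 3 only, `e^{1.18} < 4`) ∧ (TAIL `a > 59/100`: the only part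
  with a deep-negative mode, i.e. the only RH-facing part).
-/

set_option linter.dupNamespace false  -- the mandated namespace repeats `RiemannHypothesis`

noncomputable section

open Real Set Matrix

open Literature.NumberTheory.LFunctions

namespace Summit.RiemannHypothesis.RiemannHypothesis.Theorems.PfPersistence

/-! ## §1 Sign-known bottoms: the sign-blind conjuncts as plain inequalities (any datum) -/

/-- PROVED: with `0 ≤ ε₁`, the gauge conjunct is `(1 + τ) ε₁ ≤ τ ε₂`. [folklore] -/
theorem mem_gaugeRatioAt_iff_of_bottomRayleigh_nonneg {d : Datum} {win : Window}
    (h0 : 0 ≤ bottomRayleigh (d win)) (τ : ℝ) :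
    d ∈ gaugeRatioAt τ win ↔ (1 + τ) * bottomRayleigh (d win) ≤ τ * secondRayleigh (d win) := by
  show |bottomRayleigh (d win)| ≤ τ * (secondRayleigh (d win) - bottomRayleigh (d win)) ↔ _
  rw [abs_of_nonneg h0]
  have e₁ := mul_sub τ (secondRayleigh (d win)) (bottomRayleigh (d win))
  have e₂ : (1 + τ) * bottomRayleigh (d win) = bottomRayleigh (d win) + τ * bottomRayleigh (d win) := by ring
  constructor <;> intro H <;> linarith

/-- PROVED: with `0 ≤ ε₁` and `0 < N`, the modulus conjunct is `ε₁ ≤ κ ε₂`. [folklore] -/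
theorem mem_modulusRatioAt_iff_of_bottomRayleigh_nonneg {d : Datum} {win : Window} (hN : 0 < win.N)
    (h0 : 0 ≤ bottomRayleigh (d win)) (κ : ℝ) :
    d ∈ modulusRatioAt κ win ↔ bottomRayleigh (d win) ≤ κ * secondRayleigh (d win) := by
  have h12 := bottomRayleigh_le_secondRayleigh hN (d win)
  show |bottomRayleigh (d win)| ≤ κ * |secondRayleigh (d win)| ↔ _
  rw [abs_of_nonneg h0, abs_of_nonneg (h0.trans h12)]

/-- PROVED: with `ε₁ ≤ 0`, the gauge conjunct is `-ε₁ ≤ τ (ε₂ - ε₁)` (the depth reading). [folklore] -/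
theorem mem_gaugeRatioAt_iff_of_bottomRayleigh_nonpos {d : Datum} {win : Window}
    (h0 : bottomRayleigh (d win) ≤ 0) (τ : ℝ) :
    d ∈ gaugeRatioAt τ win ↔
      -bottomRayleigh (d win) ≤ τ * (secondRayleigh (d win) - bottomRayleigh (d win)) := by
  show |bottomRayleigh (d win)| ≤ τ * (secondRayleigh (d win) - bottomRayleigh (d win)) ↔ _
  rw [abs_of_nonpos h0]

/-- PROVED: with `0 ≤ ε₁`, REJECTION by the gauge conjunct is a SMALL RELATIVE GAP `τ ε₂ < (1 + τ) ε₁` — never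
negativity. [folklore] -/
theorem not_mem_gaugeRatioAt_iff_of_bottomRayleigh_nonneg {d : Datum} {win : Window}
    (h0 : 0 ≤ bottomRayleigh (d win)) (τ : ℝ) :
    d ∉ gaugeRatioAt τ win ↔ τ * secondRayleigh (d win) < (1 + τ) * bottomRayleigh (d win) := by
  rw [mem_gaugeRatioAt_iff_of_bottomRayleigh_nonneg h0 τ, not_le]

/-! ## §2 The positivity band `a ≤ 59/100` (RH-free, from the certified two-prime theorem) -/

/-- PROVED (RH-free): `0 ≤ ε(a)` for `0 < a ≤ 59/100` (`weilPositivityOn_59_100` + `weilGroundEnergy_nonneg_iff_holds`).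
[folklore] -/
theorem weilGroundEnergy_nonneg_of_le_59_100 {a : ℝ} (ha : 0 < a) (h : a ≤ 59 / 100) : 0 ≤ weilGroundEnergy a :=
  (weilGroundEnergy_nonneg_iff_holds ha).2 (weilPositivityOn_59_100.mono h)

/-- PROVED (RH-free): `0 < ε(a)` for `0 < a < 59/100` (strict antitonicity of `ε` below a positive window).
[folklore] -/
theorem weilGroundEnergy_pos_of_lt_59_100 {a : ℝ} (ha : 0 < a) (h : a < 59 / 100) : 0 < weilGroundEnergy a :=
  Summit.RiemannHypothesis.RiemannHypothesis.Theorems.WeilWindowFlowGronwallLeakage.weilGroundEnergy_pos_of_weilPositivityOn_of_lt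
    weilPositivityOn_59_100 ha h

/-- **PROVED (RH-free): `0 ≤ ε₁(ζ(a, N))` for every window with `a ≤ 59/100` and every `N`.** [folklore] -/
theorem zeta_bottomRayleigh_nonneg_of_le_59_100 (win : Window) (h : win.a ≤ 59 / 100) :
    0 ≤ bottomRayleigh (zetaDatum win) :=
  ((weilGroundEnergy_nonneg_of_le_59_100 win.ha h).trans (weilGroundEnergy_le_weilEvenGroundEnergy _)).trans
    (weilEvenGroundEnergy_le_bottomRayleigh' win)

/-- **PROVED (RH-free): `0 < ε₁(ζ(a, N))` for every window with `a < 59/100` and every `N`.** [folklore] -/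
theorem zeta_bottomRayleigh_pos_of_lt_59_100 (win : Window) (h : win.a < 59 / 100) :
    0 < bottomRayleigh (zetaDatum win) :=
  ((weilGroundEnergy_pos_of_lt_59_100 win.ha h).trans_le (weilGroundEnergy_le_weilEvenGroundEnergy _)).trans_le
    (weilEvenGroundEnergy_le_bottomRayleigh' win)

/-- PROVED (RH-free): `ζ`'s Galerkin block is `WindowPositive` at every window of the positivity band. [folklore] -/
theorem zeta_windowPositive_of_le_59_100 (win : Window) (h : win.a ≤ 59 / 100) : WindowPositive (zetaDatum win) :=
  fun v => (mul_nonneg (zeta_bottomRayleigh_nonneg_of_le_59_100 win h) (dotProduct_self_nonneg_real v)).trans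
    (bottomRayleigh_mul_le_form (zetaDatum win) v)

/-- **PROVED (RH-free): in the positivity band the gauge conjunct at `ζ` IS the relative-gap inequality.** [folklore] -/
theorem zeta_mem_gaugeRatioAt_iff_of_le_59_100 {win : Window} (h : win.a ≤ 59 / 100) (τ : ℝ) :
    zetaDatum ∈ gaugeRatioAt τ win ↔
      (1 + τ) * bottomRayleigh (zetaDatum win) ≤ τ * secondRayleigh (zetaDatum win) :=
  mem_gaugeRatioAt_iff_of_bottomRayleigh_nonneg (zeta_bottomRayleigh_nonneg_of_le_59_100 win h) τ

/-- PROVED (RH-free): in the positivity band (positive `N`) the modulus conjunct at `ζ` is `ε₁ ≤ κ ε₂`. [folklore] -/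
theorem zeta_mem_modulusRatioAt_iff_of_le_59_100 {win : Window} (hN : 0 < win.N) (h : win.a ≤ 59 / 100) (κ : ℝ) :
    zetaDatum ∈ modulusRatioAt κ win ↔ bottomRayleigh (zetaDatum win) ≤ κ * secondRayleigh (zetaDatum win) :=
  mem_modulusRatioAt_iff_of_bottomRayleigh_nonneg hN (zeta_bottomRayleigh_nonneg_of_le_59_100 win h) κ

/-- **PROVED (RH-free): NO DEEP-NEGATIVE MODE in the positivity band** — rejection of `ζ` by a gauge conjunct at a
window with `a ≤ 59/100` is a small relative gap over a nonnegative bottom. [folklore] -/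
theorem zeta_not_mem_gaugeRatioAt_iff_of_le_59_100 {win : Window} (h : win.a ≤ 59 / 100) (τ : ℝ) :
    zetaDatum ∉ gaugeRatioAt τ win ↔
      τ * secondRayleigh (zetaDatum win) < (1 + τ) * bottomRayleigh (zetaDatum win) :=
  not_mem_gaugeRatioAt_iff_of_bottomRayleigh_nonneg (zeta_bottomRayleigh_nonneg_of_le_59_100 win h) τ

/-- **PROVED (RH-free): the band premise on `[a_min, 59/100]` is a RELATIVE-GAP statement.** [folklore] -/
theorem zeta_mem_gaugeRatioClassBand_59_100_iff (amin τ : ℝ) :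
    zetaDatum ∈ GaugeRatioClassBand amin (59 / 100) τ ↔
      ∀ win : Window, amin ≤ win.a → win.a ≤ 59 / 100 → 0 < win.N →
        (1 + τ) * bottomRayleigh (zetaDatum win) ≤ τ * secondRayleigh (zetaDatum win) :=
  forall_congr' fun _ => imp_congr_right fun _ =>
    ⟨fun H h₂ hN => (zeta_mem_gaugeRatioAt_iff_of_le_59_100 h₂ τ).1 (H h₂ hN),
      fun H h₂ hN => (zeta_mem_gaugeRatioAt_iff_of_le_59_100 h₂ τ).2 (H h₂ hN)⟩

/-- PROVED (RH-free): the band premise on `[a_min, 59/100]`, modulus form. [folklore] -/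
theorem zeta_mem_modulusRatioClassBand_59_100_iff (amin κ : ℝ) :
    zetaDatum ∈ ModulusRatioClassBand amin (59 / 100) κ ↔
      ∀ win : Window, amin ≤ win.a → win.a ≤ 59 / 100 → 0 < win.N →
        bottomRayleigh (zetaDatum win) ≤ κ * secondRayleigh (zetaDatum win) :=
  forall_congr' fun _ => imp_congr_right fun _ =>
    ⟨fun H h₂ hN => (zeta_mem_modulusRatioAt_iff_of_le_59_100 hN h₂ κ).1 (H h₂ hN),
      fun H h₂ hN => (zeta_mem_modulusRatioAt_iff_of_le_59_100 hN h₂ κ).2 (H h₂ hN)⟩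

/-! ## §3 The `59/100` split of the live premise -/

/-- **PROVED (RH-free): THE 59/100 SPLIT** — `ζ ∈ GaugeRatioClassFar a_min τ` iff (BAND) the relative gap
`(1 + τ) ε₁ ≤ τ ε₂` holds at every window of `[a_min, 59/100]` AND (TAIL) the gauge conjunct holds at every window
with `a > 59/100`. Only the tail carries a deep-negative mode. [folklore] -/
theorem zeta_mem_gaugeRatioClassFar_iff_split_59_100 (amin τ : ℝ) :
    zetaDatum ∈ GaugeRatioClassFar amin τ ↔
      (∀ win : Window, amin ≤ win.a → win.a ≤ 59 / 100 → 0 < win.N →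
        (1 + τ) * bottomRayleigh (zetaDatum win) ≤ τ * secondRayleigh (zetaDatum win)) ∧
      ∀ win : Window, 59 / 100 < win.a → amin ≤ win.a → 0 < win.N → zetaDatum ∈ gaugeRatioAt τ win := by
  rw [mem_gaugeRatioClassFar_iff_band_and_tail (59 / 100), zeta_mem_gaugeRatioClassBand_59_100_iff]

/-- PROVED (RH-free): the 59/100 split, modulus form. [folklore] -/
theorem zeta_mem_modulusRatioClassFar_iff_split_59_100 (amin κ : ℝ) :
    zetaDatum ∈ ModulusRatioClassFar amin κ ↔
      (∀ win : Window, amin ≤ win.a → win.a ≤ 59 / 100 → 0 < win.N →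
        bottomRayleigh (zetaDatum win) ≤ κ * secondRayleigh (zetaDatum win)) ∧
      ∀ win : Window, 59 / 100 < win.a → amin ≤ win.a → 0 < win.N → zetaDatum ∈ modulusRatioAt κ win := by
  rw [mem_modulusRatioClassFar_iff_band_and_tail (59 / 100), zeta_mem_modulusRatioClassBand_59_100_iff]

/-- PROVED: the band `a ≤ 59/100` sees the primes `2` and `3` only (`e^{2·(59/100)} < 4`). [folklore] -/
theorem exp_two_mul_59_100_lt_four : Real.exp (2 * (59 / 100 : ℝ)) < 4 := by
  have hlog : (2 : ℝ) * (59 / 100) < Real.log 4 := by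
    have h4 : Real.log 4 = 2 * Real.log 2 := by
      rw [show (4 : ℝ) = 2 ^ 2 by norm_num, Real.log_pow]; norm_num
    have := Real.log_two_gt_d9
    rw [h4]; norm_num at this ⊢; linarith
  calc Real.exp (2 * (59 / 100)) < Real.exp (Real.log 4) := Real.exp_lt_exp.2 hlog
    _ = 4 := Real.exp_log (by norm_num)

/-- PROVED (RH-free): on the TAIL side of the split nothing is lost by the sign-blind form — at a window where `ζ`'s
bottom is `≤ 0` the gauge conjunct reads `-ε₁ ≤ τ (ε₂ - ε₁)` (depth at most `τ/(1-τ)` of the gap), and at a window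
where it is `≥ 0` it reads as in the band; the two readings exhaust the tail. [folklore] -/
theorem zeta_mem_gaugeRatioAt_tail_cases (win : Window) (τ : ℝ) :
    (0 ≤ bottomRayleigh (zetaDatum win) ∧
        (zetaDatum ∈ gaugeRatioAt τ win ↔
          (1 + τ) * bottomRayleigh (zetaDatum win) ≤ τ * secondRayleigh (zetaDatum win))) ∨
      (bottomRayleigh (zetaDatum win) ≤ 0 ∧
        (zetaDatum ∈ gaugeRatioAt τ win ↔
          -bottomRayleigh (zetaDatum win) ≤
            τ * (secondRayleigh (zetaDatum win) - bottomRayleigh (zetaDatum win)))) := by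
  rcases le_total 0 (bottomRayleigh (zetaDatum win)) with h0 | h0
  · exact Or.inl ⟨h0, mem_gaugeRatioAt_iff_of_bottomRayleigh_nonneg h0 τ⟩
  · exact Or.inr ⟨h0, mem_gaugeRatioAt_iff_of_bottomRayleigh_nonpos h0 τ⟩

end Summit.RiemannHypothesis.RiemannHypothesis.Theorems.PfPersistence

end
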